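import Summits.AtomisticToContinuum.Crystallization.Theorems.ChargedEnergyGapFibreCharge
import HarnessLib

/-!
# ChargedEnergyGap · NODE 84 «KinkBudget» (lens-3 g83) — file A of three: THE KINK BUDGET OF A MARKED FIBRE (PROVED)

Line of record `stmt-AtomisticToContinuum-14231` (`Summit.AtomisticToContinuum.ChargedEnergyGap`), route PricedLinkCensus; NODE 84 sits beneath NODE 83
«FibreCharge» (tree `…Theorems.ChargedEnergyGapFibreChargeA|B|C|∅`, cone of record `chargedEnergyGap_of_fibreCharge_numerics`, 33 hypotheses) and
attacks its ONE-DIMENSIONAL leaf (F_lo) `FibreChargeLowQ 80 (679/1000) (691/1000)`.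

THIS FILE (generic one-fibre calculus, no table beyond the index maps).  §A1 index lemmas for the kink–cost table (`capKCol` is monotone; column
`≥ c` means kink `≥ 1 + (c−2)/10`; min-depth `< 93.5 + r/2` means row `≤ r`).  §A2 THE LEG INEQUALITY `kb_leg` (PROVED, three lines): along a
discretely semiconcave sequence (`e(t+1)² + e(t−1)² ≤ 2e(t)² + 2ρ²`) the squared-depth increments `δ_s = e(s+1)² − e(s)²` grow by at most `2ρ²` per
step, so between two sites `t < t'` one has `δ_{t'−1} ≤ δ_t + 2ρ²(t' − t − 1)`, and the discrete PARABOLA `e(t+j)² ≤ e(t)² + j δ_t + ρ² j(j−1)`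
(`kb_parabola`).  §A3 local facts at a marked hole (depth `≥ 93.5` at and next to it, the outgoing drop `e(t) − e(t+1)` and the incoming rise
`e(t) − e(t−1)` are `≥ (kink − 1)ρ ≥ 0` and sum to `kink·ρ`).  §A4 ★★ THE KINK BUDGET: for two marked holes `t < t'` the leg inequality reads
`m(t)·(e(t) − e(t+1)) + m(t')·(e(t') − e(t'−1)) ≤ ρ²(t' − t − 1)` (`kb_pair_budget`: the increments at the two ends are `−(drop)(e + e₊)` and
`+(rise)(e' + e'₋)` with `e + e₊, e' + e'₋ ≥ 2·min-depth`); summed over consecutive legs every INNER hole pays its full `min-depth × kink × ρ ≥ 93.5ρ`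
while the window gives `ρ²(span) ≤ ρ(160 + 2ρ)`: hence ★★ `kb_card_le_three` — A MARKED FIBRE CARRIES AT MOST THREE HOLES (four would need `187ρ ≤
160ρ − ρ²`) — and ★★ `kb_three_budget` — for three holes `t₁ < t₂ < t₃`: `m₂·kink(t₂) + m₁·(kink(t₁) − 1) + m₃·(kink(t₃) − 1) ≤ 160` (the middle
hole pays its whole kink, the outer holes their excess over `1`).  These are the exact discrete form of the «kink budget» named ATTACKABLE-M in
NODE 83's tag of (F_lo) (crit-1 row 1487 (C)(iii)).

Files B (`…KinkBudgetB`: the table certificates, the two residual leaves (F₂¹⁰) `FibreChargeTwoTenQ` and (F₃) `FibreChargeThreeMidQ`, and (F_lo) ⟸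
(F₂¹⁰) ∧ (F₃) PROVED) and main (`…KinkBudget`: designate and cone) follow.  Imports ONLY the tree file `…ChargedEnergyGapFibreCharge` (NODE 83) and
`HarnessLib`; no `set_option`, no `sorry`, no instance, no notation, no `private`; namespace `…Theorems.ChargedEnergyGapChartDial`; new names `kb_*`.
-/

noncomputable section

open scoped Classical
open Literature.MathematicalPhysics.StatisticalMechanics Literature.Geometry.DiscreteGeometry
open Summit.AtomisticToContinuum.Crystallization.Theses.PricedLinkCensus
open Summit.AtomisticToContinuum.Crystallization.Theorems.ChargedEnergyGapNegative

namespace Summit.AtomisticToContinuum.Crystallization.Theorems.ChargedEnergyGapChartDial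

/-! ## §A1 Index lemmas for the kink–cost table -/

section Index

/-- The kink column is monotone in the kink. [formal bookkeeping] -/
theorem kb_capKCol_mono {J J' : ℝ} (h : J ≤ J') : capKCol J ≤ capKCol J' := by
  unfold capKCol
  by_cases h1 : J' < 1 / 2
  · rw [if_pos (lt_of_le_of_lt h h1), if_pos h1]
  rw [if_neg h1]
  by_cases hJ1 : J < 1 / 2
  · rw [if_pos hJ1]; exact Nat.zero_le _
  rw [if_neg hJ1]
  by_cases h2 : J' < 1
  · rw [if_pos h2, if_pos (lt_of_le_of_lt h h2)]
  rw [if_neg h2]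
  by_cases hJ2 : J < 1
  · rw [if_pos hJ2]; split_ifs <;> omega
  rw [if_neg hJ2]
  by_cases h3 : J' < 2
  · rw [if_pos h3, if_pos (lt_of_le_of_lt h h3)]
    have : ⌊(J - 1) * 10⌋₊ ≤ ⌊(J' - 1) * 10⌋₊ := Nat.floor_le_floor (by linarith)
    omega
  rw [if_neg h3]
  by_cases hJ3 : J < 2
  · rw [if_pos hJ3]
    rw [not_lt] at hJ2
    have : ⌊(J - 1) * 10⌋₊ < 10 := (Nat.floor_lt (by linarith)).2 (by push_cast; linarith)
    omega
  · rw [if_neg hJ3]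

/-- Kink column `≥ c` (`2 ≤ c ≤ 12`) means kink `≥ 1 + (c − 2)/10`. [formal bookkeeping] -/
theorem kb_le_of_capKCol (J : ℝ) (c : ℕ) (hc2 : 2 ≤ c) (hc12 : c ≤ 12) (h : c ≤ capKCol J) : 1 + ((c : ℝ) - 2) / 10 ≤ J := by
  unfold capKCol at h
  by_cases h1 : J < 1 / 2
  · rw [if_pos h1] at h; omega
  rw [if_neg h1] at h
  by_cases h2 : J < 1
  · rw [if_pos h2] at h; omega
  rw [if_neg h2] at h
  rw [not_lt] at h2
  by_cases h3 : J < 2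
  · rw [if_pos h3] at h
    have hc : c - 2 ≤ ⌊(J - 1) * 10⌋₊ := by omega
    have hc' : ((c - 2 : ℕ) : ℝ) ≤ (J - 1) * 10 := (Nat.le_floor_iff (by linarith)).1 hc
    have hcast : ((c - 2 : ℕ) : ℝ) = (c : ℝ) - 2 := by
      rw [Nat.cast_sub hc2]; push_cast; ring
    rw [hcast] at hc'
    linarith
  · rw [not_lt] at h3
    have hc' : (c : ℝ) ≤ 12 := by exact_mod_cast hc12
    linarith

/-- Min-depth `< 93.5 + r/2` (`r ≤ 73`) means table row `≤ r`. [formal bookkeeping] -/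
theorem kb_capKRow_le_of_lt (d : ℝ) (r : ℕ) (hr : r ≤ 73) (h : d < 187 / 2 + (r : ℝ) / 2) : capKRow d ≤ r := by
  unfold capKRow
  by_cases h1 : d < 187 / 2
  · rw [if_pos h1]; exact Nat.zero_le _
  rw [if_neg h1]
  rw [not_lt] at h1
  have hr' : (r : ℝ) ≤ 73 := by exact_mod_cast hr
  have h2 : d < 130 := by linarith
  rw [if_pos h2]
  have hrpos : 1 ≤ r := by
    by_contra h0
    have : r = 0 := by omega
    rw [this] at h; norm_num at h; linarith
  have hfl : ⌊(d - 187 / 2) * 2⌋₊ < r := (Nat.floor_lt (by linarith)).2 (by linarith)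
  omega

end Index

/-! ## §A2 The leg inequality and the discrete parabola (semiconcavity only) -/

section Leg

variable {ρ : ℝ} {e : ℤ → ℝ}

/-- ★ **THE LEG INEQUALITY**: along a discretely semiconcave sequence the squared-depth increments grow by at most `2ρ²` per step:
`e(t+n+1)² − e(t+n)² ≤ (e(t+1)² − e(t)²) + 2ρ² n`. -/
theorem kb_leg (hsc : ∀ t, e (t + 1) ^ 2 + e (t - 1) ^ 2 ≤ 2 * e t ^ 2 + 2 * ρ ^ 2) (t : ℤ) (n : ℕ) :
    e (t + n + 1) ^ 2 - e (t + n) ^ 2 ≤ (e (t + 1) ^ 2 - e t ^ 2) + 2 * ρ ^ 2 * n := by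
  induction n with
  | zero => simp
  | succ n ih =>
    have h := hsc (t + n + 1)
    rw [show t + (n : ℤ) + 1 - 1 = t + n by ring] at h
    push_cast
    rw [show t + ((n : ℤ) + 1) + 1 = t + n + 1 + 1 by ring, show t + ((n : ℤ) + 1) = t + n + 1 by ring]
    nlinarith [ih, h]

/-- The leg inequality between two sites `t < t'`: `e(t')² − e(t'−1)² ≤ (e(t+1)² − e(t)²) + 2ρ²(t' − t − 1)`. -/
theorem kb_leg' (hsc : ∀ t, e (t + 1) ^ 2 + e (t - 1) ^ 2 ≤ 2 * e t ^ 2 + 2 * ρ ^ 2) {t t' : ℤ} (htt : t < t') :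
    e t' ^ 2 - e (t' - 1) ^ 2 ≤ (e (t + 1) ^ 2 - e t ^ 2) + 2 * ρ ^ 2 * (((t' : ℝ) - t) - 1) := by
  obtain ⟨n, hn⟩ : ∃ n : ℕ, (n : ℤ) = t' - t - 1 := ⟨(t' - t - 1).toNat, Int.toNat_of_nonneg (by omega)⟩
  have h := kb_leg hsc t n
  have e1 : t + (n : ℤ) + 1 = t' := by omega
  have e2 : t + (n : ℤ) = t' - 1 := by omega
  rw [e1, e2] at h
  have hnR : (n : ℝ) = ((t' : ℝ) - t) - 1 := by exact_mod_cast hn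
  rw [hnR] at h
  exact h

/-- ★ **THE DISCRETE PARABOLA** (forward): `e(t+j)² ≤ e(t)² + j·(e(t+1)² − e(t)²) + ρ² j(j−1)` — the squared depth lies below the arithmetic
series started by its first increment (free flight past the closest point). -/
theorem kb_parabola (hsc : ∀ t, e (t + 1) ^ 2 + e (t - 1) ^ 2 ≤ 2 * e t ^ 2 + 2 * ρ ^ 2) (t : ℤ) (j : ℕ) :
    e (t + j) ^ 2 ≤ e t ^ 2 + (j : ℝ) * (e (t + 1) ^ 2 - e t ^ 2) + ρ ^ 2 * j * ((j : ℝ) - 1) := by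
  induction j with
  | zero => simp
  | succ j ih =>
    have h := kb_leg hsc t j
    push_cast
    rw [show t + ((j : ℤ) + 1) = t + j + 1 by ring]
    nlinarith [ih, h]

/-- Reflection `u ↦ e(c − u)` preserves discrete semiconcavity. [formal bookkeeping] -/
theorem kb_sc_reflect (hsc : ∀ t, e (t + 1) ^ 2 + e (t - 1) ^ 2 ≤ 2 * e t ^ 2 + 2 * ρ ^ 2) (c : ℤ) :
    ∀ u, (fun u => e (c - u)) (u + 1) ^ 2 + (fun u => e (c - u)) (u - 1) ^ 2 ≤ 2 * (fun u => e (c - u)) u ^ 2 + 2 * ρ ^ 2 := by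
  intro u
  have h := hsc (c - u)
  simp only
  rw [show c - (u + 1) = c - u - 1 by ring, show c - (u - 1) = c - u + 1 by ring]
  linarith

/-- Reflection preserves the Lipschitz bound. [formal bookkeeping] -/
theorem kb_lip_reflect (hlip : ∀ t, |e (t + 1) - e t| ≤ ρ) (c : ℤ) :
    ∀ u, |(fun u => e (c - u)) (u + 1) - (fun u => e (c - u)) u| ≤ ρ := by
  intro u
  have h := hlip (c - (u + 1))
  simp only
  rw [show c - (u + 1) + 1 = c - u by ring] at h
  rwa [abs_sub_comm] at h

/-- ★ The discrete parabola, backward: `e(t'−j)² ≤ e(t')² − j·(e(t')² − e(t'−1)²) + ρ² j(j−1)`. -/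
theorem kb_parabola_back (hsc : ∀ t, e (t + 1) ^ 2 + e (t - 1) ^ 2 ≤ 2 * e t ^ 2 + 2 * ρ ^ 2) (t' : ℤ) (j : ℕ) :
    e (t' - j) ^ 2 ≤ e t' ^ 2 - (j : ℝ) * (e t' ^ 2 - e (t' - 1) ^ 2) + ρ ^ 2 * j * ((j : ℝ) - 1) := by
  have h := kb_parabola (e := fun u => e (t' - u)) (kb_sc_reflect hsc t') 0 j
  simp only [sub_zero, zero_add] at h
  linarith

end Leg

/-! ## §A3 Local facts at a marked hole -/

section Hole

variable {R_N ρ : ℝ} {e m : ℤ → ℝ} {S : Finset ℤ} {t₀ : ℤ}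

/-- ★ At a marked hole `t`: min-depth `≥ 93.5` and `< 140`, kink `≥ 1`, the two neighbours are at depth `≥ m(t)`, the incoming rise
`e(t) − e(t−1)` and the outgoing drop `e(t) − e(t+1)` are both `≥ (kink − 1)ρ ≥ 0` (Lipschitz), and they sum to `kink·ρ`. -/
theorem kb_hole (hρ : 0 < ρ) (hF : IsMarkedFibre R_N ρ e m S t₀) {t : ℤ} (ht : t ∈ S) :
    187 / 2 ≤ m t ∧ m t < 140 ∧ 1 ≤ kink1 ρ e t ∧ m t ≤ e (t - 1) ∧ m t ≤ e (t + 1) ∧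
      (kink1 ρ e t - 1) * ρ ≤ e t - e (t - 1) ∧ (kink1 ρ e t - 1) * ρ ≤ e t - e (t + 1) ∧
      (e t - e (t - 1)) + (e t - e (t + 1)) = kink1 ρ e t * ρ := by
  obtain ⟨-, hlip, -, hm, -, htab, -, -⟩ := hF
  obtain ⟨hr, hc, hup⟩ := htab t ht
  have hmt := fc_le_of_capKRow _ hr
  have hkt := fc_le_of_capKCol_two _ hc
  obtain ⟨-, hm1, hm2⟩ := hm t
  have hl0 := hlip (t - 1)
  have hl1 := hlip t
  rw [show t - 1 + 1 = t by ring] at hl0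
  have h01 : e t - e (t - 1) ≤ ρ := (abs_le.1 hl0).2
  have h10 : e t - e (t + 1) ≤ ρ := by have := (abs_le.1 hl1).1; linarith
  have hk : (e t - e (t - 1)) + (e t - e (t + 1)) = kink1 ρ e t * ρ := by
    unfold kink1; field_simp; ring
  refine ⟨hmt, hup, hkt, hm1, hm2, ?_, ?_, hk⟩
  · nlinarith [hk, h10]
  · nlinarith [hk, h01]

/-- At a marked hole the depth itself is `≥` the min-depth (the incoming rise is `≥ 0`). [formal bookkeeping] -/
theorem kb_hole_depth (hρ : 0 < ρ) (hF : IsMarkedFibre R_N ρ e m S t₀) {t : ℤ} (ht : t ∈ S) :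
    m t ≤ e t ∧ 0 ≤ e t - e (t - 1) ∧ 0 ≤ e t - e (t + 1) := by
  obtain ⟨-, -, hk, hm1, -, hr, hd, -⟩ := kb_hole hρ hF ht
  have h1 : 0 ≤ (kink1 ρ e t - 1) * ρ := mul_nonneg (by linarith) hρ.le
  exact ⟨by linarith, by linarith, by linarith⟩

end Hole

/-! ## §A4 The kink budget: pair budget, at most three holes, the three-hole budget -/

section Budget

variable {R_N ρ : ℝ} {e m : ℤ → ℝ} {S : Finset ℤ} {t₀ : ℤ}

/-- ★★ **THE PAIR BUDGET**: for two marked holes `t < t'` of a marked fibre,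
`m(t)·(e(t) − e(t+1)) + m(t')·(e(t') − e(t'−1)) ≤ ρ²(t' − t − 1)` — the outgoing drop of the earlier hole and the incoming rise of the later
hole, weighted by their min-depths, are paid from the `2ρ²`-per-step growth of the squared-depth increments along the leg. -/
theorem kb_pair_budget (hρ : 0 < ρ) (hF : IsMarkedFibre R_N ρ e m S t₀) {t t' : ℤ} (ht : t ∈ S) (ht' : t' ∈ S) (htt : t < t') :
    m t * (e t - e (t + 1)) + m t' * (e t' - e (t' - 1)) ≤ ρ ^ 2 * (((t' : ℝ) - t) - 1) := by
  have hsc := hF.2.2.1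
  have hleg := kb_leg' hsc htt
  obtain ⟨hmt, hd0, hd1⟩ := kb_hole_depth hρ hF ht
  obtain ⟨hmt', hr0, hr1⟩ := kb_hole_depth hρ hF ht'
  obtain ⟨-, -, -, hm1, hm2, -⟩ := kb_hole hρ hF ht
  obtain ⟨-, -, -, hm1', hm2', -⟩ := kb_hole hρ hF ht'
  -- the two end increments, factorised
  have hA : e t' ^ 2 - e (t' - 1) ^ 2 = (e t' - e (t' - 1)) * (e t' + e (t' - 1)) := by ring
  have hB : e (t + 1) ^ 2 - e t ^ 2 = -((e t - e (t + 1)) * (e t + e (t + 1))) := by ring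
  rw [hA, hB] at hleg
  have h1 : (e t' - e (t' - 1)) * (2 * m t') ≤ (e t' - e (t' - 1)) * (e t' + e (t' - 1)) :=
    mul_le_mul_of_nonneg_left (by linarith) hr0
  have h2 : (e t - e (t + 1)) * (2 * m t) ≤ (e t - e (t + 1)) * (e t + e (t + 1)) :=
    mul_le_mul_of_nonneg_left (by linarith) hd1
  nlinarith [h1, h2, hleg]

/-- The window of a marked fibre: two marked positions `t < t'` satisfy `ρ(t' − t) ≤ 160 + 2ρ` at `R_N = 80`. [formal bookkeeping] -/
theorem kb_window (hF : IsMarkedFibre 80 ρ e m S t₀) {t t' : ℤ} (ht : t ∈ S) (ht' : t' ∈ S) (htt : t < t') :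
    ρ * ((t' : ℝ) - t) ≤ 160 + 2 * ρ := by
  obtain ⟨-, hwin⟩ := hF.2.2.2.2.1 t' ht' t ht
  rw [abs_of_nonneg (by rw [sub_nonneg]; exact_mod_cast htt.le)] at hwin
  linarith

/-- ★★ **AT MOST THREE MARKED HOLES ON A FIBRE** (`R_N = 80`, any `ρ > 0`): four marked positions `t₁ < t₂ < t₃ < t₄` would make the two inner
holes pay `m·kink·ρ ≥ 93.5ρ` each into the summed pair budgets, i.e. `187ρ ≤ ρ²(t₄ − t₁ − 3) ≤ 160ρ − ρ²`. -/
theorem kb_card_le_three (hρ : 0 < ρ) (hF : IsMarkedFibre 80 ρ e m S t₀) : S.card ≤ 3 := by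
  by_contra h4
  rw [not_le] at h4
  obtain ⟨T, hTS, hT⟩ := Finset.exists_subset_card_eq (show 4 ≤ S.card by omega)
  set f := T.orderEmbOfFin hT with hf
  have hmem : ∀ i, f i ∈ S := fun i => hTS (T.orderEmbOfFin_mem hT i)
  have hmono : StrictMono f := f.strictMono
  have h01 : f 0 < f 1 := hmono (by decide)
  have h12 : f 1 < f 2 := hmono (by decide)
  have h23 : f 2 < f 3 := hmono (by decide)
  have p1 := kb_pair_budget hρ hF (hmem 0) (hmem 1) h01
  have p2 := kb_pair_budget hρ hF (hmem 1) (hmem 2) h12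
  have p3 := kb_pair_budget hρ hF (hmem 2) (hmem 3) h23
  have hw := kb_window hF (hmem 0) (hmem 3) (h01.trans (h12.trans h23))
  obtain ⟨hm1, -, hk1, -, -, -, -, hs1⟩ := kb_hole hρ hF (hmem 1)
  obtain ⟨hm2, -, hk2, -, -, -, -, hs2⟩ := kb_hole hρ hF (hmem 2)
  obtain ⟨-, hd0, -⟩ := kb_hole_depth hρ hF (hmem 0)
  obtain ⟨-, -, hr3⟩ := kb_hole_depth hρ hF (hmem 3)
  obtain ⟨hm0, -⟩ := kb_hole hρ hF (hmem 0)
  obtain ⟨hm3, -⟩ := kb_hole hρ hF (hmem 3)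
  -- inner holes pay m·kink·ρ ≥ 93.5·ρ each
  have i1 : 187 / 2 * ρ ≤ m (f 1) * (e (f 1) - e (f 1 - 1)) + m (f 1) * (e (f 1) - e (f 1 + 1)) := by
    rw [← mul_add, hs1]; nlinarith [mul_le_mul hm1 hk1 zero_le_one (by linarith : (0 : ℝ) ≤ m (f 1)), hρ]
  have i2 : 187 / 2 * ρ ≤ m (f 2) * (e (f 2) - e (f 2 - 1)) + m (f 2) * (e (f 2) - e (f 2 + 1)) := by
    rw [← mul_add, hs2]; nlinarith [mul_le_mul hm2 hk2 zero_le_one (by linarith : (0 : ℝ) ≤ m (f 2)), hρ]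
  have o0 : 0 ≤ m (f 0) * (e (f 0) - e (f 0 + 1)) := by
    obtain ⟨-, -, hd⟩ := kb_hole_depth hρ hF (hmem 0); exact mul_nonneg (by linarith) hd
  have o3 : 0 ≤ m (f 3) * (e (f 3) - e (f 3 - 1)) := by
    obtain ⟨-, hr, -⟩ := kb_hole_depth hρ hF (hmem 3); exact mul_nonneg (by linarith) hr
  have hsum : 187 * ρ ≤ ρ ^ 2 * (((f 3 : ℤ) : ℝ) - ((f 0 : ℤ) : ℝ) - 3) := by linarith [p1, p2, p3, i1, i2, o0, o3]
  nlinarith [hsum, hw, hρ]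

/-- ★★ **THE THREE-HOLE KINK BUDGET**: for three marked holes `t₁ < t₂ < t₃` of a marked fibre (`R_N = 80`),
`m(t₂)·kink(t₂) + m(t₁)·(kink(t₁) − 1) + m(t₃)·(kink(t₃) − 1) ≤ 160` — the middle hole pays its whole kink, the outer holes their excess over `1`
(in the raw form: `m₂(2e₂ − e₂₋ − e₂₊) + m₁(e₁ − e₁₊) + m₃(e₃ − e₃₋) ≤ ρ²(t₃ − t₁ − 2) ≤ 160ρ`). -/
theorem kb_three_budget (hρ : 0 < ρ) (hF : IsMarkedFibre 80 ρ e m S t₀) {t₁ t₂ t₃ : ℤ} (h₁ : t₁ ∈ S) (h₂ : t₂ ∈ S) (h₃ : t₃ ∈ S)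
    (h12 : t₁ < t₂) (h23 : t₂ < t₃) :
    m t₂ * kink1 ρ e t₂ + m t₁ * (kink1 ρ e t₁ - 1) + m t₃ * (kink1 ρ e t₃ - 1) ≤ 160 := by
  have p1 := kb_pair_budget hρ hF h₁ h₂ h12
  have p2 := kb_pair_budget hρ hF h₂ h₃ h23
  have hw := kb_window hF h₁ h₃ (h12.trans h23)
  obtain ⟨hm1, -, -, -, -, -, hd1, -⟩ := kb_hole hρ hF h₁
  obtain ⟨hm2, -, -, -, -, -, -, hs2⟩ := kb_hole hρ hF h₂
  obtain ⟨hm3, -, -, -, -, hr3, -, -⟩ := kb_hole hρ hF h₃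
  -- outer holes: m·(kink − 1)·ρ ≤ m·(drop) resp. m·(rise)
  have o1 : m t₁ * (kink1 ρ e t₁ - 1) * ρ ≤ m t₁ * (e t₁ - e (t₁ + 1)) := by
    rw [mul_assoc]; exact mul_le_mul_of_nonneg_left hd1 (by linarith)
  have o3 : m t₃ * (kink1 ρ e t₃ - 1) * ρ ≤ m t₃ * (e t₃ - e (t₃ - 1)) := by
    rw [mul_assoc]; exact mul_le_mul_of_nonneg_left hr3 (by linarith)
  have i2 : m t₂ * kink1 ρ e t₂ * ρ = m t₂ * (e t₂ - e (t₂ - 1)) + m t₂ * (e t₂ - e (t₂ + 1)) := by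
    rw [← mul_add, hs2, mul_assoc]
  have hsum : (m t₂ * kink1 ρ e t₂ + m t₁ * (kink1 ρ e t₁ - 1) + m t₃ * (kink1 ρ e t₃ - 1)) * ρ ≤
      ρ ^ 2 * (((t₃ : ℝ) - t₁) - 2) := by
    nlinarith [p1, p2, o1, o3, i2]
  have hρw : ρ ^ 2 * (((t₃ : ℝ) - t₁) - 2) ≤ 160 * ρ := by nlinarith [hw, hρ]
  exact le_of_mul_le_mul_right (hsum.trans hρw) hρ

/-- ★ **THE TWO-HOLE KINK BUDGET**: for two marked holes `t₁ < t₂` (`R_N = 80`), `m(t₁)(kink(t₁) − 1) + m(t₂)(kink(t₂) − 1) ≤ 160 + ρ`. -/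
theorem kb_two_budget (hρ : 0 < ρ) (hF : IsMarkedFibre 80 ρ e m S t₀) {t₁ t₂ : ℤ} (h₁ : t₁ ∈ S) (h₂ : t₂ ∈ S) (h12 : t₁ < t₂) :
    m t₁ * (kink1 ρ e t₁ - 1) + m t₂ * (kink1 ρ e t₂ - 1) ≤ 160 + ρ := by
  have p1 := kb_pair_budget hρ hF h₁ h₂ h12
  have hw := kb_window hF h₁ h₂ h12
  obtain ⟨hm1, -, -, -, -, -, hd1, -⟩ := kb_hole hρ hF h₁
  obtain ⟨hm2, -, -, -, -, hr2, -, -⟩ := kb_hole hρ hF h₂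
  have o1 : m t₁ * (kink1 ρ e t₁ - 1) * ρ ≤ m t₁ * (e t₁ - e (t₁ + 1)) := by
    rw [mul_assoc]; exact mul_le_mul_of_nonneg_left hd1 (by linarith)
  have o2 : m t₂ * (kink1 ρ e t₂ - 1) * ρ ≤ m t₂ * (e t₂ - e (t₂ - 1)) := by
    rw [mul_assoc]; exact mul_le_mul_of_nonneg_left hr2 (by linarith)
  have hsum : (m t₁ * (kink1 ρ e t₁ - 1) + m t₂ * (kink1 ρ e t₂ - 1)) * ρ ≤ ρ ^ 2 * (((t₂ : ℝ) - t₁) - 1) := by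
    nlinarith [p1, o1, o2]
  have hρw : ρ ^ 2 * (((t₂ : ℝ) - t₁) - 1) ≤ (160 + ρ) * ρ := by nlinarith [hw, hρ]
  exact le_of_mul_le_mul_right (hsum.trans hρw) hρ

end Budget

end Summit.AtomisticToContinuum.Crystallization.Theorems.ChargedEnergyGapChartDial
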